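import Summits.BirchSwinnertonDyer.BirchSwinnertonDyer.Theorems.PrintCFramBottomClassIndexLawFiveLeFlipRungTwoMatrixFactorisation
import Literature.NumberTheory.EllipticCurves.HalfIntegralWeightFormsProofs
import HarnessLib

/-!
# Crux `PrintCFram.BottomClassIndexLawFiveLe` (stmt-BirchSwinnertonDyer-20372), line `eisenstein-resource-bdp-line` (registry v29 `stub_flipRungs.2`):
# THE 2-ADIC FLIPPED-CUSP RUNG, piece P3 — THE EVEN TRANSLATES AT THE FLIPPED CUSP HAVE PERIOD `1/4`
# (cell `bsd-print-cfram`, width seat `bsd-line-cfram-p1-w7` g8; THEOREMS ONLY, `--supports` 20372 `--as helper`; BSD is not proved by any of this)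

HONEST FRAMING. Nothing here is a statement about BSD; no registered stub is closed. Piece P3 of the kernel typing of (RungTwo⁶) (crux notes
`Lines/eisenstein-resource-bdp-line-w7g8-T6.md` §1b, §5c): in the class cut `P_c g = (1/8)Σ_{j mod 8} ζ₈^{−cj} g(· + j/8)` read at the flipped cusp
`W = γ₀·diag(64,1)`, `γ₀ = [[a,b],[M′,64]]`, the EVEN translates `j ∈ {0,2,4,6}` are the junk; this file proves that each of them, normalised by the same
factor `√(8(M′w+1))^K` as the odd part (P1 `…FlipRungTwoFlipIdentity`), is `1/4`-PERIODIC in `w` — so its `q`-expansion lives on the frequencies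
`4ℤ`, away from the classes `n ≢ 0 (mod 4)` that the rung reads (T3's `eq_zero_of_hasSum_qParam` trick then kills the junk coefficients; no holomorphy
of the junk is used). Mechanism: `γ₀·T¹⁶ = N₀·γ₀` with `N₀ = [[1 − 16aM′, 16a²],[−16M′², 1 + 16aM′]]`, and for even `j = 2j₁` the translation-conjugate
`N_j = τ_{j/8} N₀ τ_{−j/8} = [[1 − 16aM′ − 4j₁M′², 16a² + 8j₁aM′ + j₁²M′²],[−16M′², 1 + 16aM′ + 4j₁M′²]]` is INTEGRAL, lies in `Γ₀(4M′)`, has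
`d ≡ 1 (mod 4M′)` (so `ψ(d) = 1`, `ε_d = 1`) and `(c/d) = (−16M′²/d) = 1`; its automorphy base is `denom N_j z′ = (M′(w+¼)+1)/(M′w+1)`, and the
square-root branches multiply without sign (`csqrt_div_mul_csqrt`). We assume `0 ≤ a` (replace `(a, b)` by `(a + tM′, b + 64t)`), so that `d > 0`.

* §1 the matrices and the three point identities on `ℍ` (`64•(¼ +ᵥ w) = 16 +ᵥ 64•w`, `γ₀•(16 +ᵥ z) = N₀•(γ₀•z)`, `(j/8) +ᵥ N₀•u = N_j•((j/8) +ᵥ u)`);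
* §2 the trivial multiplier of `N_j` and its automorphy base;
* §3 **`evenTranslate_flippedCusp_periodic`**: `g((j/8) +ᵥ γ₀•(64•(¼ +ᵥ w)))·√(8(M′w+1))^K = g((j/8) +ᵥ γ₀•(64•w))·√(8(M′(w+¼)+1))^K`.

No definitions, no named facts, no `sorry`. beyond-print theorem: NO. References: [Shimura1973HalfIntegral] §1, Prop. 1.3–1.5; crux notes w7g8-T6 §1b, §5c P3.
-/

set_option autoImplicit false
-- summit-side namespace `Summit.BirchSwinnertonDyer.BirchSwinnertonDyer.…` (single-conjunct summit, D-0017 layout)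
set_option linter.dupNamespace false

noncomputable section

open Complex
open UpperHalfPlane hiding I
open scoped MatrixGroups NumberTheorySymbols Real
open Literature.NumberTheory.EllipticCurves.ModularForms (thetaEps thetaFactor shimuraSymbol autFactor shimuraSymbol_of_pos_right
  thetaEps_eq_of_emod_eq csqrt_div_mul_csqrt)

namespace Summit.BirchSwinnertonDyer.BirchSwinnertonDyer.Theorems.PrintCFram.FlipRung

/-! ## §1 The matrices `N₀ = γ₀T¹⁶γ₀⁻¹`, `N_j = τ_{j/8}N₀τ_{−j/8}` and the point identities -/

/-- `det N₀ = 1`, `N₀ = [[1 − 16aM′, 16a²],[−16M′², 1 + 16aM′]]`. [folklore] -/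
theorem det_junkN0_eq_one (a M : ℤ) : Matrix.det !![1 - 16 * a * M, 16 * a ^ 2; -16 * M ^ 2, 1 + 16 * a * M] = 1 := by
  rw [Matrix.det_fin_two_of]; ring

/-- `det N_j = 1`, `N_j = [[1 − 16aM′ − 4j₁M′², 16a² + 8j₁aM′ + j₁²M′²],[−16M′², 1 + 16aM′ + 4j₁M′²]]` (`j = 2j₁`). [folklore] -/
theorem det_junkN_eq_one (a M j₁ : ℤ) :
    Matrix.det !![1 - 16 * a * M - 4 * j₁ * M ^ 2, 16 * a ^ 2 + 8 * j₁ * a * M + j₁ ^ 2 * M ^ 2; -16 * M ^ 2, 1 + 16 * a * M + 4 * j₁ * M ^ 2] = 1 := by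
  rw [Matrix.det_fin_two_of]; ring

/-- The dilation by `64` turns the period `1/4` into the integral translation `16`: `64•(¼ +ᵥ w) = 16 +ᵥ 64•w`. [folklore] -/
theorem dilate_vadd_quarter (w : ℍ) :
    ((⟨64, by norm_num⟩ : {x : ℝ // 0 < x}) • ((((1 : ℝ) / 4) +ᵥ w) : ℍ) : ℍ) =
      (((16 : ℝ)) +ᵥ ((⟨64, by norm_num⟩ : {x : ℝ // 0 < x}) • w) : ℍ) := by
  apply UpperHalfPlane.ext
  rw [coe_pos_real_smul, coe_vadd, coe_vadd, coe_pos_real_smul]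
  simp only [Complex.real_smul]
  push_cast
  ring

/-- Möbius maps compose through fractions: `(p(x/y) + q)/(r(x/y) + s) = (px + qy)/(rx + sy)`. [folklore] -/
theorem moebius_frac (p q r s x y : ℂ) (hy : y ≠ 0) :
    (p * (x / y) + q) / (r * (x / y) + s) = (p * x + q * y) / (r * x + s * y) := by
  have h1 : p * (x / y) + q = (p * x + q * y) / y := by field_simp
  have h2 : r * (x / y) + s = (r * x + s * y) / y := by field_simp
  rw [h1, h2, div_div_div_cancel_right₀ hy]

/-- **`γ₀•(16 +ᵥ z) = N₀•(γ₀•z)`** for `γ₀ = [[a,b],[M′,64]]` (`64a − bM′ = 1`): `γ₀T¹⁶ = N₀γ₀`. [folklore] -/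
theorem cusp_vadd_sixteen_eq_smul (γ₀ N₀ : SL(2, ℤ)) {M a b : ℤ}
    (h00 : (γ₀ 0 0 : ℤ) = a) (h01 : (γ₀ 0 1 : ℤ) = b) (h10 : (γ₀ 1 0 : ℤ) = M) (h11 : (γ₀ 1 1 : ℤ) = 64)
    (n00 : (N₀ 0 0 : ℤ) = 1 - 16 * a * M) (n01 : (N₀ 0 1 : ℤ) = 16 * a ^ 2) (n10 : (N₀ 1 0 : ℤ) = -16 * M ^ 2)
    (n11 : (N₀ 1 1 : ℤ) = 1 + 16 * a * M) (z : ℍ) :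
    (γ₀ • ((((16 : ℝ)) +ᵥ z) : ℍ) : ℍ) = N₀ • (γ₀ • z) := by
  have hdetZ : a * 64 - b * M = 1 := by
    have := Matrix.SpecialLinearGroup.det_coe γ₀
    rw [Matrix.det_fin_two, h00, h01, h10, h11] at this
    linarith
  have hdet : (a : ℂ) * 64 - (b : ℂ) * (M : ℂ) = 1 := by exact_mod_cast hdetZ
  have hD1 : (M : ℂ) * (z : ℂ) + 64 ≠ 0 := by
    have := denom_ne_zero γ₀ z
    rwa [ModularGroup.denom_apply, h10, h11, Int.cast_ofNat] at this
  have hD2 : (M : ℂ) * ((16 : ℂ) + z) + 64 ≠ 0 := by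
    have := denom_ne_zero γ₀ ((((16 : ℝ)) +ᵥ z) : ℍ)
    rw [ModularGroup.denom_apply, h10, h11, coe_vadd] at this
    push_cast at this
    exact this
  -- numerator and denominator of `N₀•(γ₀•z)` after clearing the inner denominator
  have hnum : (1 - 16 * (a : ℂ) * M) * ((a : ℂ) * z + b) + 16 * (a : ℂ) ^ 2 * ((M : ℂ) * z + 64) = (a : ℂ) * (16 + z) + b := by
    linear_combination (16 * (a : ℂ)) * hdet
  have hden : -16 * (M : ℂ) ^ 2 * ((a : ℂ) * z + b) + (1 + 16 * (a : ℂ) * M) * ((M : ℂ) * z + 64) = (M : ℂ) * (16 + z) + 64 := by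
    linear_combination (16 * (M : ℂ)) * hdet
  apply UpperHalfPlane.ext
  rw [coe_specialLinearGroup_apply, coe_specialLinearGroup_apply, coe_specialLinearGroup_apply, coe_vadd, h00, h01, h10, h11,
    n00, n01, n10, n11]
  simp only [eq_intCast, Int.cast_ofNat]
  push_cast
  rw [moebius_frac _ _ _ _ _ _ hD1, hnum, hden]

/-- **`(j/8) +ᵥ N₀•u = N_j•((j/8) +ᵥ u)`** for even `j = 2j₁` (the conjugate of `N₀` by the translation `j/8` is the integral `N_j`). [folklore] -/
theorem translate_junkN0_eq_smul (N₀ N : SL(2, ℤ)) {M a : ℤ} {j₁ : ℕ}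
    (n00 : (N₀ 0 0 : ℤ) = 1 - 16 * a * M) (n01 : (N₀ 0 1 : ℤ) = 16 * a ^ 2) (n10 : (N₀ 1 0 : ℤ) = -16 * M ^ 2)
    (n11 : (N₀ 1 1 : ℤ) = 1 + 16 * a * M)
    (m00 : (N 0 0 : ℤ) = 1 - 16 * a * M - 4 * j₁ * M ^ 2) (m01 : (N 0 1 : ℤ) = 16 * a ^ 2 + 8 * j₁ * a * M + j₁ ^ 2 * M ^ 2)
    (m10 : (N 1 0 : ℤ) = -16 * M ^ 2) (m11 : (N 1 1 : ℤ) = 1 + 16 * a * M + 4 * j₁ * M ^ 2) (u : ℍ) :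
    (((((2 * j₁ : ℕ) : ℝ) / 8) +ᵥ (N₀ • u)) : ℍ) = N • (((((2 * j₁ : ℕ) : ℝ) / 8) +ᵥ u) : ℍ) := by
  have hD : ((-16 * M ^ 2 : ℤ) : ℂ) * (u : ℂ) + ((1 + 16 * a * M : ℤ) : ℂ) ≠ 0 := by
    have := denom_ne_zero N₀ u
    rwa [ModularGroup.denom_apply, n10, n11] at this
  apply UpperHalfPlane.ext
  rw [coe_vadd, coe_specialLinearGroup_apply, coe_specialLinearGroup_apply, coe_vadd, n00, n01, n10, n11, m00, m01, m10, m11]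
  simp only [eq_intCast]
  push_cast at hD ⊢
  have hD' : -16 * (M : ℂ) ^ 2 * (2 * (j₁ : ℂ) / 8 + u) + (1 + 16 * (a : ℂ) * M + 4 * (j₁ : ℂ) * M ^ 2) ≠ 0 := by
    have e : -16 * (M : ℂ) ^ 2 * (2 * (j₁ : ℂ) / 8 + u) + (1 + 16 * (a : ℂ) * M + 4 * (j₁ : ℂ) * M ^ 2) =
        -16 * (M : ℂ) ^ 2 * u + (1 + 16 * (a : ℂ) * M) := by ring
    rw [e]; exact hD
  rw [add_div' _ _ _ hD, div_eq_div_iff hD hD']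
  ring

/-- **THE EVEN TRANSLATES OF THE FLIPPED CUSP UNDER `w ↦ w + ¼`**: `(j/8) +ᵥ γ₀•(64•(¼ +ᵥ w)) = N_j • ((j/8) +ᵥ γ₀•(64•w))`, `j = 2j₁`.
[cite: Shimura1973HalfIntegral, Prop. 1.5 (proof)] -/
theorem evenTranslate_flippedCusp_vadd_quarter (γ₀ N₀ N : SL(2, ℤ)) {M a b : ℤ} {j₁ : ℕ}
    (h00 : (γ₀ 0 0 : ℤ) = a) (h01 : (γ₀ 0 1 : ℤ) = b) (h10 : (γ₀ 1 0 : ℤ) = M) (h11 : (γ₀ 1 1 : ℤ) = 64)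
    (n00 : (N₀ 0 0 : ℤ) = 1 - 16 * a * M) (n01 : (N₀ 0 1 : ℤ) = 16 * a ^ 2) (n10 : (N₀ 1 0 : ℤ) = -16 * M ^ 2)
    (n11 : (N₀ 1 1 : ℤ) = 1 + 16 * a * M)
    (m00 : (N 0 0 : ℤ) = 1 - 16 * a * M - 4 * j₁ * M ^ 2) (m01 : (N 0 1 : ℤ) = 16 * a ^ 2 + 8 * j₁ * a * M + j₁ ^ 2 * M ^ 2)
    (m10 : (N 1 0 : ℤ) = -16 * M ^ 2) (m11 : (N 1 1 : ℤ) = 1 + 16 * a * M + 4 * j₁ * M ^ 2) (w : ℍ) :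
    (((((2 * j₁ : ℕ) : ℝ) / 8) +ᵥ γ₀ • ((⟨64, by norm_num⟩ : {x : ℝ // 0 < x}) • ((((1 : ℝ) / 4) +ᵥ w) : ℍ))) : ℍ) =
      N • (((((2 * j₁ : ℕ) : ℝ) / 8) +ᵥ γ₀ • ((⟨64, by norm_num⟩ : {x : ℝ // 0 < x}) • w)) : ℍ) := by
  rw [dilate_vadd_quarter, cusp_vadd_sixteen_eq_smul γ₀ N₀ h00 h01 h10 h11 n00 n01 n10 n11,
    translate_junkN0_eq_smul N₀ N n00 n01 n10 n11 m00 m01 m10 m11]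

/-! ## §2 The multiplier of `N_j` is trivial and its automorphy base is `(M′(w+¼)+1)/(M′w+1)` -/

/-- `d(N_j) = 1 + 16aM′ + 4j₁M′² ≡ 1 (mod 4M′)`. [folklore] -/
theorem junkN_d_cast_eq_one (M : ℕ) (a : ℤ) (j₁ : ℕ) :
    (((1 + 16 * a * (M : ℤ) + 4 * (j₁ : ℤ) * (M : ℤ) ^ 2 : ℤ)) : ZMod (4 * M)) = 1 := by
  have e : ((1 + 16 * a * (M : ℤ) + 4 * (j₁ : ℤ) * (M : ℤ) ^ 2 : ℤ)) = 1 + ((4 * M : ℕ) : ℤ) * (4 * a + (j₁ : ℤ) * M) := by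
    push_cast; ring
  rw [e, Int.cast_add, Int.cast_one, Int.cast_mul, Int.cast_natCast, ZMod.natCast_self, zero_mul, add_zero]

/-- `ε_{d(N_j)} = 1` (`d ≡ 1 (mod 4)`). [folklore] -/
theorem thetaEps_junkN_eq_one (M a : ℤ) (j₁ : ℕ) : thetaEps (1 + 16 * a * M + 4 * (j₁ : ℤ) * M ^ 2) = 1 := by
  have e : (1 + 16 * a * M + 4 * (j₁ : ℤ) * M ^ 2) % 4 = 1 := by
    have : (1 + 16 * a * M + 4 * (j₁ : ℤ) * M ^ 2) = 1 + 4 * (4 * a * M + (j₁ : ℤ) * M ^ 2) := by ring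
    rw [this, Int.add_mul_emod_self_left]; norm_num
  simp only [thetaEps, e]
  norm_num

/-- `(c/d) = (−16M′²/d) = 1` for `d = d(N_j) > 0`, `d ≡ 1 (mod 4M′)` (`(−1/d) = 1` as `d ≡ 1 (4)`; `((4M′)²/d) = 1` as `gcd(4M′, d) = 1`). [folklore] -/
theorem shimuraSymbol_junkN_eq_one {M a : ℤ} {j₁ : ℕ} (hd : 0 < 1 + 16 * a * M + 4 * (j₁ : ℤ) * M ^ 2) :
    shimuraSymbol (-16 * M ^ 2) (1 + 16 * a * M + 4 * (j₁ : ℤ) * M ^ 2) = 1 := by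
  set d : ℤ := 1 + 16 * a * M + 4 * (j₁ : ℤ) * M ^ 2 with hd_def
  obtain ⟨n, hn⟩ := Int.eq_ofNat_of_zero_le hd.le
  have hd4 : d % 4 = 1 := by
    have : d = 1 + 4 * (4 * a * M + (j₁ : ℤ) * M ^ 2) := by rw [hd_def]; ring
    rw [this, Int.add_mul_emod_self_left]; norm_num
  rw [hn] at hd4
  have hn1 : n % 4 = 1 := by omega
  have hodd : Odd n := Nat.odd_iff.mpr (by omega)
  rw [shimuraSymbol_of_pos_right _ hd, hn, Int.natAbs_natCast,
    show (-16 * M ^ 2 : ℤ) = -1 * (4 * M) ^ 2 by ring, jacobiSym.mul_left, jacobiSym.at_neg_one hodd,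
    ZMod.χ₄_nat_one_mod_four hn1, one_mul]
  refine jacobiSym.sq_one' (Int.isCoprime_iff_gcd_eq_one.mp ⟨-(4 * a + (j₁ : ℤ) * M), 1, ?_⟩)
  rw [← hn]
  ring

/-- THE AUTOMORPHY BASE OF `N_j` AT THE TRANSLATE: `denom N_j ((j/8) +ᵥ γ₀•(64•w)) · 8(M′w+1) = 8(M′(w+¼)+1)`. [folklore] -/
theorem denom_junkN_mul (γ₀ N : SL(2, ℤ)) {M a b : ℤ} {j₁ : ℕ}
    (h00 : (γ₀ 0 0 : ℤ) = a) (h01 : (γ₀ 0 1 : ℤ) = b) (h10 : (γ₀ 1 0 : ℤ) = M) (h11 : (γ₀ 1 1 : ℤ) = 64)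
    (m10 : (N 1 0 : ℤ) = -16 * M ^ 2) (m11 : (N 1 1 : ℤ) = 1 + 16 * a * M + 4 * j₁ * M ^ 2) (w : ℍ) :
    denom N (((((2 * j₁ : ℕ) : ℝ) / 8) +ᵥ γ₀ • ((⟨64, by norm_num⟩ : {x : ℝ // 0 < x}) • w)) : ℍ) * (8 * ((M : ℂ) * w + 1)) =
      8 * ((M : ℂ) * (((((1 : ℝ) / 4) +ᵥ w) : ℍ) : ℂ) + 1) := by
  have hdetZ : a * 64 - b * M = 1 := by
    have := Matrix.SpecialLinearGroup.det_coe γ₀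
    rw [Matrix.det_fin_two, h00, h01, h10, h11] at this
    linarith
  have hdet : (a : ℂ) * 64 - (b : ℂ) * (M : ℂ) = 1 := by exact_mod_cast hdetZ
  have hw1 : (M : ℂ) * w + 1 ≠ 0 := by
    intro h
    have h2 := denom_ne_zero γ₀ (((⟨64, by norm_num⟩ : {x : ℝ // 0 < x}) • w : ℍ))
    rw [ModularGroup.denom_apply, h10, h11, coe_pos_real_smul] at h2
    simp only [Complex.real_smul, Int.cast_ofNat] at h2
    apply h2
    push_cast
    linear_combination (64 : ℂ) * h
  have hQ : (M : ℂ) * (64 * (w : ℂ)) + 64 = 64 * ((M : ℂ) * w + 1) := by ring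
  have hPQ : ((a : ℂ) * (64 * (w : ℂ)) + b) / ((M : ℂ) * (64 * (w : ℂ)) + 64) * (8 * ((M : ℂ) * w + 1)) =
      ((a : ℂ) * (64 * (w : ℂ)) + b) / 8 := by
    rw [hQ, div_mul_eq_mul_div, div_eq_div_iff (mul_ne_zero (by norm_num) hw1) (by norm_num)]
    ring
  rw [ModularGroup.denom_apply, m10, m11, coe_vadd, coe_specialLinearGroup_apply, coe_pos_real_smul, h00, h01, h10, h11, coe_vadd]
  simp only [eq_intCast, Complex.real_smul, Int.cast_ofNat]
  push_cast
  calc (-16 * (M : ℂ) ^ 2 * (2 * (j₁ : ℂ) / 8 + ((a : ℂ) * (64 * (w : ℂ)) + b) / ((M : ℂ) * (64 * (w : ℂ)) + 64)) +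
          (1 + 16 * (a : ℂ) * M + 4 * (j₁ : ℂ) * M ^ 2)) * (8 * ((M : ℂ) * w + 1))
        = (1 + 16 * (a : ℂ) * M) * (8 * ((M : ℂ) * w + 1)) -
            16 * (M : ℂ) ^ 2 * (((a : ℂ) * (64 * (w : ℂ)) + b) / ((M : ℂ) * (64 * (w : ℂ)) + 64) * (8 * ((M : ℂ) * w + 1))) := by
          ring
    _ = (1 + 16 * (a : ℂ) * M) * (8 * ((M : ℂ) * w + 1)) - 16 * (M : ℂ) ^ 2 * (((a : ℂ) * (64 * (w : ℂ)) + b) / 8) := by rw [hPQ]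
    _ = 8 * ((M : ℂ) * ((1 : ℂ) / 4 + w) + 1) := by linear_combination (2 * (M : ℂ)) * hdet

/-! ## §3 The even translates are `1/4`-periodic after the common normalisation -/

/-- **THE EVEN TRANSLATES AT THE FLIPPED CUSP HAVE PERIOD `1/4`.** For `M′ : ℕ`, `γ₀ = [[a,b],[M′,64]] ∈ SL₂(ℤ)` with `0 ≤ a`, `g : ℍ → ℂ` with
`g(γ•z) = autFactor K (4M′) ψ γ z·g(z)` on `Γ₀(4M′)`, even `j = 2j₁` and `w ∈ ℍ`:
`g((j/8) +ᵥ γ₀•(64•(¼ +ᵥ w)))·√(8(M′w+1))^K = g((j/8) +ᵥ γ₀•(64•w))·√(8(M′(w+¼)+1))^K`. So `w ↦ g((j/8) +ᵥ γ₀•(64•w))/√(8(M′w+1))^K`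
(the normalisation of P1's odd part) is `¼`-periodic, and its `q`-series lives on `4ℤ`. [cite: Shimura1973HalfIntegral, §1, Prop. 1.5] -/
theorem evenTranslate_flippedCusp_periodic {M : ℕ} {a b : ℤ} (ha : 0 ≤ a) (γ₀ : SL(2, ℤ))
    (h00 : (γ₀ 0 0 : ℤ) = a) (h01 : (γ₀ 0 1 : ℤ) = b) (h10 : (γ₀ 1 0 : ℤ) = M) (h11 : (γ₀ 1 1 : ℤ) = 64)
    {K : ℕ} {ψ : DirichletCharacter ℂ (4 * M)} {g : ℍ → ℂ}
    (hg : ∀ γ ∈ CongruenceSubgroup.Gamma0 (4 * M), ∀ z : ℍ, g (γ • z) = autFactor K (4 * M) ψ γ z * g z) (j₁ : ℕ) (w : ℍ) :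
    g (((((2 * j₁ : ℕ) : ℝ) / 8) +ᵥ γ₀ • ((⟨64, by norm_num⟩ : {x : ℝ // 0 < x}) • ((((1 : ℝ) / 4) +ᵥ w) : ℍ))) : ℍ) *
        Complex.sqrt (8 * ((M : ℂ) * w + 1)) ^ K =
      g (((((2 * j₁ : ℕ) : ℝ) / 8) +ᵥ γ₀ • ((⟨64, by norm_num⟩ : {x : ℝ // 0 < x}) • w)) : ℍ) *
        Complex.sqrt (8 * ((M : ℂ) * (((((1 : ℝ) / 4) +ᵥ w) : ℍ) : ℂ) + 1)) ^ K := by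
  have hdetZ : a * 64 - b * (M : ℤ) = 1 := by
    have := Matrix.SpecialLinearGroup.det_coe γ₀
    rw [Matrix.det_fin_two, h00, h01, h10, h11] at this
    linarith
  have hM0 : 0 < M := by
    rcases Nat.eq_zero_or_pos M with h | h
    · exfalso; subst h; simp at hdetZ; omega
    · exact h
  -- the matrices
  let N₀ : SL(2, ℤ) := ⟨!![1 - 16 * a * M, 16 * a ^ 2; -16 * (M : ℤ) ^ 2, 1 + 16 * a * M], det_junkN0_eq_one a M⟩
  let N : SL(2, ℤ) := ⟨!![1 - 16 * a * M - 4 * (j₁ : ℤ) * (M : ℤ) ^ 2, 16 * a ^ 2 + 8 * (j₁ : ℤ) * a * M + (j₁ : ℤ) ^ 2 * (M : ℤ) ^ 2;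
    -16 * (M : ℤ) ^ 2, 1 + 16 * a * M + 4 * (j₁ : ℤ) * (M : ℤ) ^ 2], det_junkN_eq_one a M j₁⟩
  have n00 : (N₀ 0 0 : ℤ) = 1 - 16 * a * M := rfl
  have n01 : (N₀ 0 1 : ℤ) = 16 * a ^ 2 := rfl
  have n10 : (N₀ 1 0 : ℤ) = -16 * (M : ℤ) ^ 2 := rfl
  have n11 : (N₀ 1 1 : ℤ) = 1 + 16 * a * M := rfl
  have m00 : (N 0 0 : ℤ) = 1 - 16 * a * M - 4 * (j₁ : ℤ) * (M : ℤ) ^ 2 := rfl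
  have m01 : (N 0 1 : ℤ) = 16 * a ^ 2 + 8 * (j₁ : ℤ) * a * M + (j₁ : ℤ) ^ 2 * (M : ℤ) ^ 2 := rfl
  have m10 : (N 1 0 : ℤ) = -16 * (M : ℤ) ^ 2 := rfl
  have m11 : (N 1 1 : ℤ) = 1 + 16 * a * M + 4 * (j₁ : ℤ) * (M : ℤ) ^ 2 := rfl
  have hN : N ∈ CongruenceSubgroup.Gamma0 (4 * M) := by
    rw [CongruenceSubgroup.Gamma0_mem, m10,
      show (-16 * (M : ℤ) ^ 2 : ℤ) = ((4 * M : ℕ) : ℤ) * (-4 * (M : ℤ)) by push_cast; ring,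
      Int.cast_mul, Int.cast_natCast, ZMod.natCast_self, zero_mul]
  -- the flipped translate of `w + ¼` is `N • z′`
  set z' : ℍ := ((((2 * j₁ : ℕ) : ℝ) / 8) +ᵥ γ₀ • ((⟨64, by norm_num⟩ : {x : ℝ // 0 < x}) • w)) with hz'
  rw [evenTranslate_flippedCusp_vadd_quarter γ₀ N₀ N h00 h01 h10 h11 n00 n01 n10 n11 m00 m01 m10 m11 w, hg N hN z']
  -- the multiplier of `N` is trivial
  have hdpos : 0 < 1 + 16 * a * (M : ℤ) + 4 * (j₁ : ℤ) * (M : ℤ) ^ 2 := by positivity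
  have hfac : autFactor K (4 * M) ψ N z' = Complex.sqrt (denom N z') ^ K := by
    simp only [autFactor, thetaFactor]
    rw [m10, m11, junkN_d_cast_eq_one M a j₁, map_one, one_mul, thetaEps_junkN_eq_one, shimuraSymbol_junkN_eq_one hdpos,
      inv_one, one_mul, Int.cast_one, one_mul, ModularGroup.denom_apply, m10, m11]
  -- the base: `denom N z′ = X/u`
  have hu : (8 * ((M : ℂ) * w + 1)) ≠ 0 := by
    have him : (8 * ((M : ℂ) * w + 1)).im = 8 * (M * w.im) := by simp [Complex.mul_im, Complex.add_im]
    intro h; have := congrArg Complex.im h; rw [him, Complex.zero_im] at this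
    have : 0 < (8 : ℝ) * (M * w.im) := by have := w.im_pos; positivity
    linarith
  have hXu : denom N z' = (8 * ((M : ℂ) * (((((1 : ℝ) / 4) +ᵥ w) : ℍ) : ℂ) + 1)) / (8 * ((M : ℂ) * w + 1)) := by
    rw [eq_div_iff hu]; exact denom_junkN_mul γ₀ N h00 h01 h10 h11 m10 m11 w
  have huim : 0 < (8 * ((M : ℂ) * w + 1)).im := by
    have him : (8 * ((M : ℂ) * w + 1)).im = 8 * (M * w.im) := by simp [Complex.mul_im, Complex.add_im]
    rw [him]; have := w.im_pos; positivity
  have hXim : 0 ≤ (8 * ((M : ℂ) * (((((1 : ℝ) / 4) +ᵥ w) : ℍ) : ℂ) + 1)).im := by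
    have him : (8 * ((M : ℂ) * (((((1 : ℝ) / 4) +ᵥ w) : ℍ) : ℂ) + 1)).im = 8 * (M * ((((1 : ℝ) / 4) +ᵥ w) : ℍ).im) := by
      rw [← UpperHalfPlane.coe_im]; simp [Complex.mul_im, Complex.add_im]
    rw [him]; have := ((((1 : ℝ) / 4) +ᵥ w) : ℍ).im_pos; positivity
  have hX : (8 * ((M : ℂ) * (((((1 : ℝ) / 4) +ᵥ w) : ℍ) : ℂ) + 1)) ≠ 0 := by
    intro h
    have h2 := denom_ne_zero N z'
    rw [hXu, h, zero_div] at h2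
    exact h2 rfl
  rw [hfac, hXu, mul_comm (Complex.sqrt _ ^ K) (g z'), mul_assoc, ← mul_pow, csqrt_div_mul_csqrt huim hX hXim]

end Summit.BirchSwinnertonDyer.BirchSwinnertonDyer.Theorems.PrintCFram.FlipRung

end
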